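import Summits.CriticalPhenomena.PercolationContinuityZ3.Theorems.SahiMasterFamilyMeetStratum

/-!
# A member containing the intersection of ALL the others is enough: the total-meet rung of the `k → k+1` step, every `k`

Companion of `SahiMasterFamilyMeetStratum.lean` (crux `NoHeavyLowerTail`, stmt-CriticalPhenomena-4575; unit `prim-masterthm-p4`), sharpening its
stratum "a member absorbs every PAIRWISE meet of the others" (seat `prim-l12-p5`'s hierarchy identity) to "a member absorbs the TOTAL meet
of the others": `U_m ⊇ ⋂_{j ≠ m} U_j`.

THE MECHANISM (any probability weight, nonnegative functions; no lattice, no FKG).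
* `sahiE_cons_eq_sub_sum_killed` — for ANY `d`: `E_{n+3}(d, f) = (n + 2 − E d)·E_{n+2}(f) − Σ_l E_{n+2}(f_l(1 − d), f_{−l})` (Lieb–Sahi recursion at the
  slot of `d`, multilinearity, and moving the modified slot to the head; seat p5's computation without its annihilation hypothesis).
* `sahiE_cons_nonpos_of_killed_head` — **a KILLED head slot gives a nonpositive functional**: if `r ≥ 0` and `r·∏_j g_j ≡ 0`, and every
  sub-family of `g` has `E ≥ 0`, then `E_{m+2}(r, g_0,…,g_m) ≤ 0`, by induction on `m` along the recursion
  `E_{m+2}(r, g) = Σ_j E_{m+1}(g_j r, g_{−j}) − E(r)E_{m+1}(g)` (the head `g_j r` is again killed by the remaining product; base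
  `E_2(r, g_0) = −E(r)E(g_0)` when `r g_0 = 0`).  This is the defect expansion of seat p5
  (`E_n(A,D) = (n−1−μD)E_{n−1}(A) + Σ_T |T|!·μ(⋂_T A ∖ D)·E_{n−1−|T|}(A∖T)`, `E_0 := −1`; checked exactly here for `n ≤ 6`) read as an inequality:
  when `D ⊇ ⋂ A` its only negative term `−(n−1)!·μ(⋂A ∖ D)` vanishes.
* `sahiE_cons_ge_of_absorb_prod` — hence if `d ≤ 1` absorbs the total product (`(∏_j f_j)·d = ∏_j f_j`):
  `E_{n+3}(d, f) ≥ (n + 2 − E d)·E_{n+2}(f) ≥ 0`, and `E_{n+3}(d, f) = 0 ⇒ E_{n+2}(f) = 0` (heredity at the absorbing slot).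
EVENTS (product measure, increasing events; every `k`): `sahiE_ind_nonneg_of_totalMeet` — GIVEN `MasterFamilyNonneg (k+2)`, a family of `k + 3` increasing
events with a member `U_m ⊇ ⋂_{j≠m} U_j` has `E_{k+3} ≥ 0`; `sahiE_ind_eq_zero_iff_of_totalMeet` — GIVEN `MasterFamilyEqIff (k+2)`, `E_{k+3} = 0 ↔ Z_{k+3}`
(`p` interior); unconditional at order 3, order 4 given `MasterFamilyEqIff 3`.
REACH (exact p-free census, unit code `residual_census.py` / kit): EVERY quadruple of up-sets of `{0,1}^3` has such a member (8 855/8 855), so with this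
sixth stratum the one-step residual class of `E_4` on `{0,1}^3` is EMPTY; `E_3` on `{0,1}^4`: 45 406 / 804 440 residual (at order 3 the total and pairwise
meets coincide); `E_4` on `{0,1}^4`: kit job (unit notes).  Since `⋂_{j≠m} U_j` shrinks as `k` grows, for fixed `ι` the stratum eventually contains
every antichain: the `k`-induction's hard core sits at SMALL `k` relative to `|ι|`.  HONEST FRAMING: nothing here asserts `C_k` or (EQ-k) for
`k ≥ 3`. [this work] -/

set_option autoImplicit false

open Finset
open scoped Classical

namespace Summit.CriticalPhenomena.PercolationContinuityZ3.Theorems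

open Literature.Combinatorics.Sahi2008
open MeasureTheory Function
open Literature.Probability.Percolation (DeterminedBy)
open Literature.Probability.Percolation.DecisionTree (ind ind_of_mem ind_of_not_mem ind_nonneg)

/-! ### Functions: the identity at a slot, and the killed-head inequality -/

section Functions

variable {α : Type*} [Fintype α]

/-- **The recursion at the slot of `d`, with the modified slots moved to the head** (any weight, any functions):
`E_{n+3}(d, f) = (n + 2 − E d)·E_{n+2}(f) − Σ_l E_{n+2}(f_l·(1 − d), f_{−l})`. [this work] -/
theorem sahiE_cons_eq_sub_sum_killed (μ : α → ℝ) (n : ℕ) (d : α → ℝ) (f : Fin (n + 2) → α → ℝ) :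
    sahiE μ (n + 3) (Fin.cons d f : Fin (n + 3) → α → ℝ)
      = ((n : ℝ) + 2 - ex μ d) * sahiE μ (n + 2) f
        - ∑ i, sahiE μ (n + 2) (Fin.cons (f i - f i * d) (i.removeNth f) : Fin (n + 2) → α → ℝ) := by
  rw [sahiE_fin_cons]
  have hterm : ∀ i, sahiE μ (n + 2) (update f i (f i * d))
      = sahiE μ (n + 2) f - sahiE μ (n + 2) (Fin.cons (f i - f i * d) (i.removeNth f) : Fin (n + 2) → α → ℝ) := by
    intro i
    set r : α → ℝ := f i - f i * d with hr
    have hsplit : f i * d = f i + (-1 : ℝ) • r := by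
      funext x
      simp only [hr, Pi.mul_apply, Pi.add_apply, Pi.smul_apply, Pi.sub_apply, smul_eq_mul]
      ring
    rw [hsplit, sahiE_update_add, sahiE_update_smul, update_eq_self, SahiMeetTowerAll.sahiE_update_eq_sahiE_cons]
    have e : sahiE μ (n + 1 + 1) (Fin.cons r (i.removeNth f) : Fin (n + 1 + 1) → α → ℝ)
        = sahiE μ (n + 2) (Fin.cons r (i.removeNth f) : Fin (n + 2) → α → ℝ) := rfl
    rw [e]; ring
  simp only [hterm]
  rw [Finset.sum_sub_distrib, Finset.sum_const, Finset.card_univ, Fintype.card_fin, nsmul_eq_mul]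
  have e2 : sahiE μ (n + 1 + 1) f = sahiE μ (n + 2) f := rfl
  rw [e2]
  push_cast
  ring

/-- **A killed head slot gives a nonpositive functional.**  For a nonnegative probability weight, nonnegative `g_0,…,g_m`, and `r ≥ 0` with
`r·∏_j g_j ≡ 0`: if every sub-family of `g` (along an injection) has `E ≥ 0`, then `E_{m+2}(r, g) ≤ 0`. [this work] -/
theorem sahiE_cons_nonpos_of_killed_head (μ : α → ℝ) (hμ0 : ∀ x, 0 ≤ μ x) :
    ∀ (m : ℕ) (g : Fin (m + 1) → α → ℝ) (r : α → ℝ), (∀ i x, 0 ≤ g i x) → (∀ x, 0 ≤ r x) →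
      (∀ x, r x * ∏ i, g i x = 0) →
      (∀ (j : ℕ) (e : Fin (j + 1) ↪ Fin (m + 1)), 0 ≤ sahiE μ (j + 1) (fun l => g (e l))) →
      sahiE μ (m + 2) (Fin.cons r g : Fin (m + 2) → α → ℝ) ≤ 0
  | 0, g, r, hg0, hr0, hkill, hpos => by
    rw [sahiE_fin_cons]
    have hz : ∀ x, g 0 x * r x = 0 := fun x => by
      have h := hkill x
      rw [Fin.prod_univ_one] at h
      linarith [h, mul_comm (r x) (g 0 x)]
    have h0 : sahiE μ 1 (update g 0 (g 0 * r)) = 0 := by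
      rw [sahiE_one_apply, update_self, ex]
      exact Finset.sum_eq_zero fun x _ => by rw [Pi.mul_apply, hz x, mul_zero]
    rw [Fin.sum_univ_one, h0, zero_sub, neg_nonpos, sahiE_one_apply]
    exact mul_nonneg (ex_nonneg hμ0 (hg0 0)) (ex_nonneg hμ0 hr0)
  | m + 1, g, r, hg0, hr0, hkill, hpos => by
    rw [sahiE_fin_cons]
    have hE : 0 ≤ sahiE μ (m + 2) g := by
      have := hpos (m + 1) (Function.Embedding.refl _)
      exact this
    have hterm : ∀ i, sahiE μ (m + 2) (update g i (g i * r)) ≤ 0 := by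
      intro i
      rw [SahiMeetTowerAll.sahiE_update_eq_sahiE_cons]
      refine sahiE_cons_nonpos_of_killed_head μ hμ0 m (i.removeNth g) (g i * r) (fun j x => hg0 _ x)
        (fun x => mul_nonneg (hg0 i x) (hr0 x)) (fun x => ?_) (fun j e => ?_)
      · have h := hkill x
        rw [Fin.prod_univ_succAbove (fun j => g j x) i] at h
        simp only [Fin.removeNth, Pi.mul_apply]
        linarith [h, show g i x * r x * ∏ j, g (i.succAbove j) x = r x * (g i x * ∏ j, g (i.succAbove j) x) by ring]
      · exact hpos j ⟨fun l => i.succAbove (e l), fun a b hab => e.injective (Fin.succAbove_right_injective hab)⟩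
    have hsum : ∑ i, sahiE μ (m + 2) (update g i (g i * r)) ≤ 0 := Finset.sum_nonpos fun i _ => hterm i
    have hprod : 0 ≤ sahiE μ (m + 2) g * ex μ r := mul_nonneg hE (ex_nonneg hμ0 hr0)
    have e2 : sahiE μ (m + 1 + 1) g = sahiE μ (m + 2) g := rfl
    rw [e2]
    linarith

/-- **The total-meet rung.**  Probability weight, nonnegative slots, `0 ≤ d ≤ 1` absorbing the TOTAL product `(∏_j f_j)·d = ∏_j f_j`: if every
sub-family of `f` (along an injection) has `E ≥ 0` then `(n + 2 − E d)·E_{n+2}(f) ≤ E_{n+3}(d, f)`; in particular `E_{n+3}(d, f) ≥ 0`.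
[this work] -/
theorem sahiE_cons_ge_of_absorb_prod (μ : α → ℝ) (hμ0 : ∀ x, 0 ≤ μ x) (n : ℕ) (d : α → ℝ)
    (f : Fin (n + 2) → α → ℝ) (hf0 : ∀ i x, 0 ≤ f i x) (hd1 : ∀ x, d x ≤ 1)
    (habs : ∀ x, (∏ i, f i x) * d x = ∏ i, f i x)
    (hpos : ∀ (j : ℕ) (e : Fin (j + 1) ↪ Fin (n + 2)), 0 ≤ sahiE μ (j + 1) (fun l => f (e l))) :
    ((n : ℝ) + 2 - ex μ d) * sahiE μ (n + 2) f ≤ sahiE μ (n + 3) (Fin.cons d f : Fin (n + 3) → α → ℝ) := by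
  rw [sahiE_cons_eq_sub_sum_killed μ n d f]
  have hterm : ∀ i, sahiE μ (n + 2) (Fin.cons (f i - f i * d) (i.removeNth f) : Fin (n + 2) → α → ℝ) ≤ 0 := by
    intro i
    refine sahiE_cons_nonpos_of_killed_head μ hμ0 n (i.removeNth f) (f i - f i * d) (fun j x => hf0 _ x)
      (fun x => ?_) (fun x => ?_) (fun j e => ?_)
    · simp only [Pi.sub_apply, Pi.mul_apply]; nlinarith [hf0 i x, hd1 x]
    · have h := habs x
      rw [Fin.prod_univ_succAbove (fun j => f j x) i] at h
      simp only [Fin.removeNth, Pi.sub_apply, Pi.mul_apply]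
      linarith [h, show (f i x - f i x * d x) * ∏ j, f (i.succAbove j) x
        = f i x * ∏ j, f (i.succAbove j) x - (f i x * ∏ j, f (i.succAbove j) x) * d x by ring]
    · exact hpos j ⟨fun l => i.succAbove (e l), fun a b hab => e.injective (Fin.succAbove_right_injective hab)⟩
  have hsum : ∑ i, sahiE μ (n + 2) (Fin.cons (f i - f i * d) (i.removeNth f) : Fin (n + 2) → α → ℝ) ≤ 0 :=
    Finset.sum_nonpos fun i _ => hterm i
  linarith

end Functions

/-! ### Events under a product measure -/

section Events

variable {ι : Type} [Fintype ι]

omit [Fintype ι] in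
/-- A finite product of indicators is the indicator of the intersection. [folklore] -/
theorem prod_ind_eq_ind_iInter {n : ℕ} (V : Fin n → Set (Set ι)) (ω : Set ι) :
    ∏ i, ind (V i) ω = ind (⋂ i, V i) ω := by
  by_cases h : ω ∈ ⋂ i, V i
  · rw [ind_of_mem h]
    exact Finset.prod_eq_one fun i _ => ind_of_mem (Set.mem_iInter.1 h i)
  · rw [ind_of_not_mem h]
    obtain ⟨i, hi⟩ : ∃ i, ω ∉ V i := by simpa [Set.mem_iInter] using h
    exact Finset.prod_eq_zero (Finset.mem_univ i) (ind_of_not_mem hi)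

/-- **Positivity on the total-meet stratum (every `k`).**  GIVEN `MasterFamilyNonneg (k+2)`, a family of `k + 3` increasing events with a member
`U_m ⊇ ⋂_{j} U_{m.succAbove j}` (the intersection of all the others) has `E_{k+3}(μ_p; 1_U) ≥ 0`, every `p ∈ [0,1]^ι`; indeed
`E_{k+3}(1_U) ≥ (k + 2 − P(U_m))·E_{k+2}(1_{U_{−m}})`. [this work] -/
theorem sahiE_ind_ge_of_totalMeet {k : ℕ} (hN : MasterFamilyNonneg (k + 2)) (p : ι → unitInterval)
    (U : Fin (k + 3) → Set (Set ι)) (hU : ∀ j, IsUpperSet (U j)) (m : Fin (k + 3))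
    (hmeet : (⋂ j, U (m.succAbove j)) ⊆ U m) :
    ((k : ℝ) + 2 - ex (bernoulliWeight p) (ind (U m))) * sahiE (bernoulliWeight p) (k + 2) (fun j => ind (U (m.succAbove j))) ≤
      sahiE (bernoulliWeight p) (k + 3) (fun j => ind (U j)) := by
  obtain ⟨τ, hτ⟩ := exists_perm_sahiE_ind_eq_cons (bernoulliWeight p) U m
  rw [hτ, ← sahiE_ind_comp_perm (bernoulliWeight p) τ (fun j => U (m.succAbove j))]
  refine sahiE_cons_ge_of_absorb_prod (bernoulliWeight p) (isFKGMeasure_bernoulliWeight p).nonneg k (ind (U m))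
    (fun j => ind (U (m.succAbove (τ j)))) (fun i ω => ind_nonneg _ _) (ind_le_one' (U m))
    (fun ω => ?_) (fun j e => ?_)
  · rw [prod_ind_eq_ind_iInter]
    have hsub : (⋂ i, U (m.succAbove (τ i))) ⊆ U m := by
      refine Set.Subset.trans (fun ω hω => Set.mem_iInter.2 fun j => ?_) hmeet
      have := Set.mem_iInter.1 hω (τ.symm j)
      rwa [Equiv.apply_symm_apply] at this
    by_cases hω : ω ∈ ⋂ i, U (m.succAbove (τ i))
    · rw [ind_of_mem hω, ind_of_mem (hsub hω), one_mul]
    · rw [ind_of_not_mem hω, zero_mul]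
  · exact masterFamilyNonneg_antitone (show j + 1 ≤ k + 2 by simpa using Fintype.card_le_of_embedding e) hN ι p
      (fun l => U (m.succAbove (τ (e l)))) fun l => hU _

/-- **Positivity on the total-meet stratum (every `k`)**: `E_{k+3}(μ_p; 1_U) ≥ 0` under the hypotheses of `sahiE_ind_ge_of_totalMeet`. [this work] -/
theorem sahiE_ind_nonneg_of_totalMeet {k : ℕ} (hN : MasterFamilyNonneg (k + 2)) (p : ι → unitInterval)
    (U : Fin (k + 3) → Set (Set ι)) (hU : ∀ j, IsUpperSet (U j)) (m : Fin (k + 3))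
    (hmeet : (⋂ j, U (m.succAbove j)) ⊆ U m) :
    0 ≤ sahiE (bernoulliWeight p) (k + 3) (fun j => ind (U j)) := by
  refine le_trans (mul_nonneg ?_ (hN ι p _ fun j => hU _)) (sahiE_ind_ge_of_totalMeet hN p U hU m hmeet)
  have := ex_bernoulliWeight_ind_le_one p (U m)
  have hk : (0 : ℝ) ≤ k := Nat.cast_nonneg k
  linarith

/-- **The zero locus on the total-meet stratum (every `k`).**  GIVEN `MasterFamilyEqIff (k+2)`, for `p` in the open cube a family of `k + 3`
increasing events with a member `U_m ⊇ ⋂_{j≠m} U_j` has `E_{k+3}(μ_p; 1_U) = 0 ↔ U ∈ Z_{k+3}` (a zero forces `E_{k+2}(U_{−m}) = 0`: heredity at the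
absorbing slot). [this work] -/
theorem sahiE_ind_eq_zero_iff_of_totalMeet {k : ℕ} (hE : MasterFamilyEqIff (k + 2)) (p : ι → unitInterval)
    (hp : ∀ e, (p e : ℝ) ∈ Set.Ioo (0 : ℝ) 1) (U : Fin (k + 3) → Set (Set ι)) (hU : ∀ j, IsUpperSet (U j)) (m : Fin (k + 3))
    (hmeet : (⋂ j, U (m.succAbove j)) ⊆ U m) :
    sahiE (bernoulliWeight p) (k + 3) (fun j => ind (U j)) = 0 ↔ SuppZeroFlag (k + 3) U := by
  have hN : MasterFamilyNonneg (k + 2) := masterFamilyNonneg_of_masterFamilyEqIff hE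
  refine ⟨fun h0 => ?_, fun hZ => masterFamilyEqIff_mpr (k + 3) ι p U hZ⟩
  have hge := sahiE_ind_ge_of_totalMeet hN p U hU m hmeet
  rw [h0] at hge
  have hcoef : 0 < (k : ℝ) + 2 - ex (bernoulliWeight p) (ind (U m)) := by
    have := ex_bernoulliWeight_ind_le_one p (U m)
    have hk : (0 : ℝ) ≤ k := Nat.cast_nonneg k
    linarith
  have hdel0 : 0 ≤ sahiE (bernoulliWeight p) (k + 2) (fun j => ind (U (m.succAbove j))) := hN ι p _ fun j => hU _
  have hdel : sahiE (bernoulliWeight p) (k + 2) (fun j => ind (U (m.succAbove j))) = 0 :=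
    le_antisymm (le_of_mul_le_mul_left (by rw [mul_zero]; exact hge) hcoef) hdel0
  have hZ : SuppZeroFlag (k + 2) (fun j => U (m.succAbove j)) := (hE ι p hp _ fun j => hU _).1 hdel
  exact (masterFamily_step hN hE p hp U hU m hZ).2.1 h0

/-- **Unconditionally at order 3**: `U_i ∩ U_j ⊆ U_m` ⇒ `E_3 ≥ 0 ∧ (E_3 = 0 ↔ Z_3)` (interior `p`). [this work] -/
theorem sahiE_three_ind_eq_zero_iff_of_totalMeet (p : ι → unitInterval) (hp : ∀ e, (p e : ℝ) ∈ Set.Ioo (0 : ℝ) 1)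
    (U : Fin 3 → Set (Set ι)) (hU : ∀ j, IsUpperSet (U j)) (m : Fin 3) (hmeet : (⋂ j, U (m.succAbove j)) ⊆ U m) :
    0 ≤ sahiE (bernoulliWeight p) 3 (fun j => ind (U j)) ∧
      (sahiE (bernoulliWeight p) 3 (fun j => ind (U j)) = 0 ↔ SuppZeroFlag 3 U) :=
  ⟨sahiE_ind_nonneg_of_totalMeet (masterFamilyNonneg_of_le_two le_rfl) p U hU m hmeet,
    sahiE_ind_eq_zero_iff_of_totalMeet masterFamilyEqIff_two p hp U hU m hmeet⟩

/-- **At order 4, given `MasterFamilyEqIff 3`**: a quadruple of increasing events with a member containing the intersection of the other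
three has `E_4 ≥ 0` and `E_4 = 0 ↔ Z_4` — by the census this is EVERY quadruple of up-sets of `{0,1}^3`. [this work] -/
theorem sahiE_four_ind_eq_zero_iff_of_totalMeet (hE : MasterFamilyEqIff 3) (p : ι → unitInterval)
    (hp : ∀ e, (p e : ℝ) ∈ Set.Ioo (0 : ℝ) 1) (U : Fin 4 → Set (Set ι)) (hU : ∀ j, IsUpperSet (U j)) (m : Fin 4)
    (hmeet : (⋂ j, U (m.succAbove j)) ⊆ U m) :
    0 ≤ sahiE (bernoulliWeight p) 4 (fun j => ind (U j)) ∧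
      (sahiE (bernoulliWeight p) 4 (fun j => ind (U j)) = 0 ↔ SuppZeroFlag 4 U) :=
  ⟨sahiE_ind_nonneg_of_totalMeet (masterFamilyNonneg_of_masterFamilyEqIff hE) p U hU m hmeet,
    sahiE_ind_eq_zero_iff_of_totalMeet hE p hp U hU m hmeet⟩

end Events

end Summit.CriticalPhenomena.PercolationContinuityZ3.Theorems
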